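import Summits.QuantumFields.GaugeBoot.TorusActionDerivLocality
import Summits.QuantumFields.GaugeBoot.BootstrapCentreSymmetry
import Summits.QuantumFields.GaugeBoot.ConjInvariantRowsNoInformation
import Summits.QuantumFields.GaugeBoot.StrongCouplingOrderPlaquette
import HarnessLib

/-!
# An UNCONDITIONAL jump: the level-`n` SDP upper bound of `(∏_{m<n} Re (U_{e_m})₀₀) · ∂_{i,a}S` jumps at `β = 0` (gauge-boot, L1/L4 supplement)

HONEST FRAMING (cell `pub-gaugeboot`, page 1 of every file): the venture produces certified bounds
on lattice expectations at stated coupling, gauge group, dimension and torus size; NOT a mass gap,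
NOT a continuum limit, NOT a string tension; NOT Yang–Mills-summit-bearing (barriers
`FixedCouplingUltralocality`, `PerturbativeInvisibility`). Structural; it certifies no number.

## Content

`BootstrapCouplingJump` reduced the jump of the level-`n` SDP value at `β = 0` for the pinned
objective `P = f · ∂_{i,a}S` to `P ∉ V_n`. Here `P ∉ V_n` is PROVED for
`f = ∏_{m<n} Re ρ(U_{e_m})₀₀` (`n` distinct links `e_m` sharing no plaquette with `i`), by the
ANOVA annihilator of `LinkAveraging`: the `n + 1` centrings at `e_0, …, e_{n-1}, i` kill `V_n` but
map `P` to `∏_m (Re ρ(U_{e_m})₀₀ - c) · (∂_{i,a}S - E_i ∂_{i,a}S) ≠ 0`.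

* `linkAvg_reEntry` (`E_l Re ρ(U_l)_{ab} = (∫ Re ρ_{ab} dHaar) · 1`), `killL_prod_reEntry_mul`
  (the annihilator on such products), `apply_eq_of_forall_indepOf`, `prod_sub_const_mul_ne_zero`;
* `exists_torusActionDeriv_ne_zero_suN` — `SU(N)`, `N ≥ 2`, `L ≥ 2`, two directions: some
  `∂_{i,a}S ≠ 0` (else the Wilson state at `β = 1` would kill every shift derivative and have the
  Haar plaquette mean `0`, contradicting `integral_plaquette_wilsonMeasure_pos_suN`);
* ★★★ `prod_reEntry_mul_torusActionDeriv_not_mem_suN` — `SU(N)`, `N ≥ 2`: for `∂_{i,a}S ≠ 0` and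
  `n` distinct links `e_m ≠ i` sharing no plaquette with `i`,
  `(∏_{m<n} Re (U_{e_m})₀₀) · ∂_{i,a}S ∉ V_n`;
* ★★★ `sSup_levelValues_prodEntry_jump_suN`, `not_continuousAt_zero_sSup_levelValues_prodEntry_suN`
  — hence (level `n ≥ 4`) the level-`n` SDP upper bound of this explicit word observable of length
  `n + 4` is `0` at every `β ≠ 0`, strictly positive at `β = 0`, and NOT continuous (not lower
  semicontinuous) at `β = 0`; the lower bound is strictly negative at `β = 0`.

What this is NOT: an enumeration of the exceptional couplings of `BootstrapValueContinuity` (only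
`β = 0` is exhibited); existence of the links `e_m` is a hypothesis (it holds as soon as the torus
has `n` links off the `2(d-1)` plaquettes through `i`, e.g. `L ≥ n + 3`).

References: B. Efron, C. Stein, Ann. Statist. 9 (1981) 586; folklore.
-/

noncomputable section

open MeasureTheory Filter Topology NormedSpace
open Literature.MathematicalPhysics.QuantumFieldTheory (LatticeRep Site Edge GaugeConfig plaquetteHolonomy
  wilsonAction wilsonMeasure haarProbability isProbabilityMeasure_wilsonMeasure)
open Literature.MathematicalPhysics.QuantumLattice

namespace Summit.QuantumFields.GaugeBoot

/-! ## The annihilator on a product of one-link generators -/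

section General

variable {ι : Type*} [DecidableEq ι] {G : Type*} [Group G] [TopologicalSpace G] [IsTopologicalGroup G]
  [CompactSpace G] [MeasurableSpace G] [BorelSpace G] (r : LatticeRep G)

/-- **`E_l Re ρ(U_l)_{ab}` is the constant `∫ Re ρ(g)_{ab} dg`.** -/
theorem linkAvg_reEntry (l : ι) (a b : Fin r.N) :
    linkAvg l (reEntry r l a b) =
      (∫ g : G, (r.ρ g a b).re ∂haarProbability G) • (1 : C(ι → G, ℝ)) := by
  ext U
  rw [linkAvg_apply', ContinuousMap.smul_apply, ContinuousMap.one_apply, smul_eq_mul, mul_one]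
  refine integral_congr_ae (Eventually.of_forall fun g => ?_)
  show reEntry r l a b (Function.update U l g) = (r.ρ g a b).re
  rw [reEntry_apply, Function.update_self]

omit [IsTopologicalGroup G] [CompactSpace G] [MeasurableSpace G] [BorelSpace G] in
/-- A generator at `e ≠ l` does not depend on `l`. -/
theorem indepOf_reEntry {l e : ι} (h : e ≠ l) (a b : Fin r.N) : IndepOf l (reEntry r e a b) :=
  fun U y => by simp [reEntry_apply, Function.update_of_ne h]

/-- ★ **The annihilator on `(∏_{m<n} Re ρ(U_{e_m})_{ab}) · h`**, partial stage `k ≤ n`: the first `k`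
factors are centred, the rest untouched (`e` injective on `{0,…,n}`, `h` independent of
`e_0,…,e_{n-1}`). -/
theorem killL_prod_reEntry_mul_aux {n : ℕ} {e : ℕ → ι} (he : Set.InjOn e (Set.Iio (n + 1)))
    (a b : Fin r.N) {h : C(ι → G, ℝ)} (hh : ∀ m, m < n → IndepOf (e m) h) {k : ℕ} (hk : k ≤ n) :
    killL e k ((∏ m ∈ Finset.range n, reEntry r (e m) a b) * h) =
      (∏ m ∈ Finset.range k, (reEntry r (e m) a b -
          (∫ g : G, (r.ρ g a b).re ∂haarProbability G) • (1 : C(ι → G, ℝ)))) *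
        ((∏ m ∈ Finset.Ico k n, reEntry r (e m) a b) * h) := by
  induction k with
  | zero => rw [killL_zero, Finset.range_zero, Finset.prod_empty, one_mul, Finset.range_eq_Ico]
  | succ k ih =>
    have hkn : k < n := hk
    rw [killL_succ, ih hkn.le, Finset.prod_eq_prod_Ico_succ_bot hkn, Finset.prod_range_succ]
    -- independence of everything but the `k`-th generator from `e k`
    have hne : ∀ m, m < n + 1 → m ≠ k → e m ≠ e k := fun m hm hmk heq =>
      hmk (he hm (show k < n + 1 by omega) heq)
    have hA : IndepOf (e k) (∏ m ∈ Finset.range k, (reEntry r (e m) a b -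
        (∫ g : G, (r.ρ g a b).re ∂haarProbability G) • (1 : C(ι → G, ℝ)))) :=
      IndepOf.prod _ fun m hm => (indepOf_reEntry r (hne m (by
        have := Finset.mem_range.1 hm; omega) (by have := Finset.mem_range.1 hm; omega)) a b).sub
          (indepOf_const _ _)
    have hB : IndepOf (e k) (∏ m ∈ Finset.Ico (k + 1) n, reEntry r (e m) a b) :=
      IndepOf.prod _ fun m hm => indepOf_reEntry r (hne m (by
        have := (Finset.mem_Ico.1 hm).2; omega) (by have := (Finset.mem_Ico.1 hm).1; omega)) a b
    have hY := (hA.mul hB).mul (hh k hkn)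
    set A := ∏ m ∈ Finset.range k, (reEntry r (e m) a b -
        (∫ g : G, (r.ρ g a b).re ∂haarProbability G) • (1 : C(ι → G, ℝ))) with hAdef
    set B := ∏ m ∈ Finset.Ico (k + 1) n, reEntry r (e m) a b with hBdef
    have hre : A * (reEntry r (e k) a b * B * h) = reEntry r (e k) a b * (A * B * h) := by ring
    rw [hre, linkAvg_mul_of_indepOf' hY, linkAvg_reEntry]
    ring

/-- ★ **The full annihilator**: `killL e (n+1) ((∏_{m<n} Re ρ(U_{e_m})_{ab}) · h) =
(∏_{m<n} (Re ρ(U_{e_m})_{ab} - c)) · (h - E_{e_n} h)`. -/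
theorem killL_prod_reEntry_mul {n : ℕ} {e : ℕ → ι} (he : Set.InjOn e (Set.Iio (n + 1)))
    (a b : Fin r.N) {h : C(ι → G, ℝ)} (hh : ∀ m, m < n → IndepOf (e m) h) :
    killL e (n + 1) ((∏ m ∈ Finset.range n, reEntry r (e m) a b) * h) =
      (∏ m ∈ Finset.range n, (reEntry r (e m) a b -
          (∫ g : G, (r.ρ g a b).re ∂haarProbability G) • (1 : C(ι → G, ℝ)))) *
        (h - linkAvg (e n) h) := by
  rw [killL_succ, killL_prod_reEntry_mul_aux r he a b hh le_rfl, Finset.Ico_self, Finset.prod_empty,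
    one_mul]
  have hA : IndepOf (e n) (∏ m ∈ Finset.range n, (reEntry r (e m) a b -
      (∫ g : G, (r.ρ g a b).re ∂haarProbability G) • (1 : C(ι → G, ℝ)))) :=
    IndepOf.prod _ fun m hm => by
      have hm' := Finset.mem_range.1 hm
      refine (indepOf_reEntry r (fun heq => ?_) a b).sub (indepOf_const _ _)
      exact absurd (he (show m < n + 1 by omega) (show n < n + 1 by omega) heq) (by omega)
  rw [linkAvg_mul_of_indepOf hA, mul_sub]

omit [Group G] [IsTopologicalGroup G] [CompactSpace G] [MeasurableSpace G] [BorelSpace G] in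
/-- **Functions independent of the links of `T` do not see changes on `T`.** -/
theorem apply_eq_of_forall_indepOf {f : C(ι → G, ℝ)} (T : Finset ι) (hT : ∀ l ∈ T, IndepOf l f)
    {U V : ι → G} (hUV : ∀ l, l ∉ T → U l = V l) : f U = f V := by
  induction T using Finset.induction_on generalizing U V with
  | empty => exact congrArg f (funext fun l => hUV l (by simp))
  | insert l₀ T hl₀ ih =>
    have h1 : f (Function.update U l₀ (V l₀)) = f U := hT l₀ (Finset.mem_insert_self _ _) U (V l₀)
    rw [← h1]
    refine ih (fun l hl => hT l (Finset.mem_insert_of_mem hl)) fun l hl => ?_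
    by_cases h : l = l₀
    · subst h; rw [Function.update_self]
    · rw [Function.update_of_ne h]
      exact hUV l (by simp [h, hl])

omit [IsTopologicalGroup G] [CompactSpace G] [MeasurableSpace G] [BorelSpace G] in
/-- ★ **Non-vanishing of the annihilated product**: if some `x ∈ G` has `Re ρ(x)_{ab} ≠ c`, `B ≠ 0`,
and `B` is independent of the links `e_0, …, e_{n-1}`, then
`(∏_{m<n} (Re ρ(U_{e_m})_{ab} - c)) · B ≠ 0`. -/
theorem prod_sub_const_mul_ne_zero {n : ℕ} (e : ℕ → ι) (a b : Fin r.N) {c : ℝ} {x : G}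
    (hx : (r.ρ x a b).re ≠ c) {B : C(ι → G, ℝ)} (hB : B ≠ 0) (hBi : ∀ m, m < n → IndepOf (e m) B) :
    (∏ m ∈ Finset.range n, (reEntry r (e m) a b - c • (1 : C(ι → G, ℝ)))) * B ≠ 0 := by
  classical
  obtain ⟨V, hV⟩ := DFunLike.ne_iff.1 hB
  set T := (Finset.range n).image e with hT
  set U : ι → G := fun l => if l ∈ T then x else V l with hU
  have hBU : B U = B V := by
    refine apply_eq_of_forall_indepOf T (fun l hl => ?_) fun l hl => by simp [hU, hl]
    obtain ⟨m, hm, rfl⟩ := Finset.mem_image.1 hl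
    exact hBi m (Finset.mem_range.1 hm)
  have hAU : (∏ m ∈ Finset.range n, (reEntry r (e m) a b - c • (1 : C(ι → G, ℝ)))) U =
      ((r.ρ x a b).re - c) ^ n := by
    rw [ContinuousMap.coe_prod, Finset.prod_apply]
    have h : ∀ m ∈ Finset.range n, (reEntry r (e m) a b - c • (1 : C(ι → G, ℝ))) U = (r.ρ x a b).re - c := by
      intro m hm
      have hmem : e m ∈ T := Finset.mem_image_of_mem e hm
      simp [hU, hmem, reEntry_apply]
    rw [Finset.prod_congr rfl h, Finset.prod_const, Finset.card_range]
  intro h0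
  have h1 := congrArg (fun F : C(ι → G, ℝ) => F U) h0
  simp only [ContinuousMap.mul_apply, ContinuousMap.zero_apply, hAU, hBU] at h1
  rcases mul_eq_zero.1 h1 with h2 | h2
  · exact hx (sub_eq_zero.1 (pow_eq_zero_iff'.1 h2).1)
  · exact hV (by simpa using h2)

omit [DecidableEq ι] [IsTopologicalGroup G] [CompactSpace G] [MeasurableSpace G] [BorelSpace G] in
/-- A product of `n` generators at links of `T` is a word observable of length `≤ n` on `T`. -/
theorem prod_reEntry_mem_wordSpace {T : Set ι} {e : ℕ → ι} (a b : Fin r.N) {n : ℕ}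
    (he : ∀ m, m < n → e m ∈ T) : (∏ m ∈ Finset.range n, reEntry r (e m) a b) ∈ wordSpace r T n := by
  induction n with
  | zero => simpa using one_mem_wordSpace r T 0
  | succ n ih =>
    rw [Finset.prod_range_succ]
    exact mul_mem_wordSpace r (ih fun m hm => he m (by omega))
      (mem_wordSpace_of_mem_entryGensOn r (reEntry_mem_entryGensOn (he n (by omega)) a b) le_rfl)

end General

/-! ## `SU(N)` on the torus -/

section SuN

variable {d L : ℕ} [NeZero L] (N : ℕ)

/-- **Some shift derivative of the Wilson action is non-zero** (`SU(N)`, `N ≥ 2`, `L ≥ 2`, two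
distinct directions): otherwise the Wilson state at `β = 1` would satisfy the `β = 0` loop
equations, hence have the Haar plaquette mean `0`. -/
theorem exists_torusActionDeriv_ne_zero_suN [Fact (1 < L)] (hN : 2 ≤ N) {j j' : Fin d} (hjj' : j ≠ j') :
    ∃ (i : Edge d L) (a : SuGenerator N),
      torusActionDeriv (fundamentalLatticeRep N) (suExp N) i a ≠ 0 := by
  by_contra hall
  simp only [not_exists, not_not] at hall
  haveI : ∀ β : ℝ, IsProbabilityMeasure (wilsonMeasure (d := d) (L := L) (fundamentalRep (Fin N)) β) :=
    fun β => isProbabilityMeasure_wilsonMeasure (ρ := fundamentalRep (Fin N)) (continuous_fundamentalRep _) β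
  set φ := expectationFunctional (wilsonMeasure (d := d) (L := L) (fundamentalRep (Fin N)) 1) with hφ
  have hfeas := isBootstrapFeasible_wilson_suN (d := d) (L := L) N 1 _ rfl
    (wordTruncation_subset_polyAlgebra (fundamentalLatticeRep N) 4)
  -- the Wilson state at `β = 1` kills every shift derivative of a level-`4` test function
  have hrows : ∀ (i : Edge d L) (a : SuGenerator N),
      ∀ f ∈ wordTruncation (ι := Edge d L) (fundamentalLatticeRep N) 4, φ (sderiv (suExp N) i a f) = 0 := by
    intro i a f hf
    rw [hfeas.rows_sderiv (suExp_add N) (X := fun X : SuGenerator N => (X : Matrix (Fin N) (Fin N) ℂ))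
      (rho_suExp N) (hasDerivAt_torusActionDeriv (fundamentalLatticeRep N) (suExp_add N) (rho_suExp N))
      (wordTruncation_subset_polyAlgebra _ 4) i a hf, hall i a, mul_zero, map_zero, mul_zero]
  have hP := plaquetteTraceCM_mem_wordTruncation (fundamentalLatticeRep N) (0 : Site d L) j j'
  have h := apply_eq_haar_of_rows_zero_suN N hP φ hrows
  rw [hφ, expectationFunctional_one, one_mul, expectationFunctional_apply] at h
  -- the two plaquette means differ
  have hpos := integral_plaquette_wilsonMeasure_pos_suN (d := d) (L := L) hN one_pos (0 : Site d L) hjj'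
  have hzero := integral_plaquette_haar_suN (d := d) (L := L) hN (0 : Site d L) hjj'
  rw [← wilsonMeasure_zero_eq_pi (d := d) (L := L) (fundamentalRep (Fin N))] at hzero
  have h1 : ∫ U, plaquetteTraceCM (fundamentalLatticeRep N) (0 : Site d L) j j' U
      ∂(wilsonMeasure (d := d) (L := L) (fundamentalRep (Fin N)) 1) =
      (N : ℝ)⁻¹ * ∫ U, (fundamentalRep (Fin N) (plaquetteHolonomy U 0 j j')).trace.re
        ∂(wilsonMeasure (d := d) (L := L) (fundamentalRep (Fin N)) 1) := by
    rw [← integral_const_mul]; rfl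
  have h0 : ∫ U, plaquetteTraceCM (fundamentalLatticeRep N) (0 : Site d L) j j' U
      ∂(wilsonMeasure (d := d) (L := L) (fundamentalRep (Fin N)) 0) =
      (N : ℝ)⁻¹ * ∫ U, (fundamentalRep (Fin N) (plaquetteHolonomy U 0 j j')).trace.re
        ∂(wilsonMeasure (d := d) (L := L) (fundamentalRep (Fin N)) 0) := by
    rw [← integral_const_mul]; rfl
  rw [h1, h0, hzero, mul_zero] at h
  have hN0 : (0 : ℝ) < (N : ℝ)⁻¹ := inv_pos.2 (by exact_mod_cast (show 0 < N by omega))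
  have := mul_pos hN0 hpos
  linarith

/-- **Two values of `Re g₀₀` on `SU(N)`, `N ≥ 2`**: `1` (at `g = 1`) and `cos(2π/N) < 1` (at the
centre generator); so some `x` has `Re x₀₀ ≠ c`. -/
theorem exists_re_entry_ne_suN (hN : 2 ≤ N) (a₀ : Fin N) (c : ℝ) :
    ∃ x : Matrix.specialUnitaryGroup (Fin N) ℂ,
      ((fundamentalLatticeRep N).ρ x a₀ a₀).re ≠ c := by
  have hcos : Real.cos (2 * Real.pi / N) < 1 := by
    have hNr : (2 : ℝ) ≤ N := by exact_mod_cast hN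
    have h1 : 0 < 2 * Real.pi / N := div_pos (by positivity) (by linarith)
    have h2 : 2 * Real.pi / N ≤ Real.pi := by
      rw [div_le_iff₀ (by linarith)]; nlinarith [Real.pi_pos]
    have h := Real.cos_lt_cos_of_nonneg_of_le_pi le_rfl h2 h1
    rwa [Real.cos_zero] at h
  by_cases hc : c = 1
  · refine ⟨centreRoot N, ?_⟩
    change ((centrePhase N • (1 : Matrix (Fin N) (Fin N) ℂ)) a₀ a₀).re ≠ c
    rw [hc, Matrix.smul_apply, Matrix.one_apply_eq, smul_eq_mul, mul_one, (centrePhase_re_im N).1]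
    exact hcos.ne
  · refine ⟨1, ?_⟩
    change ((1 : Matrix (Fin N) (Fin N) ℂ) a₀ a₀).re ≠ c
    rw [Matrix.one_apply_eq, Complex.one_re]
    exact Ne.symm hc

/-- ★★★ **An explicit objective outside `V_n`.** `SU(N)`, `N ≥ 2`, torus; `∂_{i,a}S ≠ 0`; `e_0, …,
e_{n-1}` distinct links, different from `i` and sharing no plaquette with `i`. Then
`(∏_{m<n} Re (U_{e_m})₀₀) · ∂_{i,a}S` is NOT a combination of words of length `≤ n` (the ANOVA
annihilator at `e_0, …, e_{n-1}, i` kills `V_n` but not this product). -/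
theorem prod_reEntry_mul_torusActionDeriv_not_mem_suN (hN : 2 ≤ N) (a₀ : Fin N) {n : ℕ} {i : Edge d L}
    {a : SuGenerator N} (hS : torusActionDeriv (fundamentalLatticeRep N) (suExp N) i a ≠ 0)
    {e : ℕ → Edge d L} (he : Set.InjOn e (Set.Iio n)) (hei : ∀ m, m < n → e m ≠ i)
    (hfar : ∀ m, m < n → ∀ (x : Site d L) (j j' : Fin d), i ∈ plaqEdges x j j' → e m ∉ plaqEdges x j j') :
    (∏ m ∈ Finset.range n, reEntry (fundamentalLatticeRep N) (e m) a₀ a₀) *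
        torusActionDeriv (fundamentalLatticeRep N) (suExp N) i a ∉
      wordTruncation (ι := Edge d L) (fundamentalLatticeRep N) n := by
  -- the annihilation sequence `e_0, …, e_{n-1}, i`
  set e' : ℕ → Edge d L := fun m => if m < n then e m else i with he'
  have he'lt : ∀ m, m < n → e' m = e m := fun m hm => by simp [he', hm]
  have he'n : e' n = i := by simp [he']
  have hinj : Set.InjOn e' (Set.Iio (n + 1)) := by
    intro m hm m' hm' hmm'
    simp only [Set.mem_Iio] at hm hm'
    by_cases h1 : m < n <;> by_cases h2 : m' < n
    · rw [he'lt m h1, he'lt m' h2] at hmm'; exact he h1 h2 hmm'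
    · rw [he'lt m h1, show e' m' = i by simp [he', h2]] at hmm'; exact absurd hmm' (hei m h1)
    · rw [he'lt m' h2, show e' m = i by simp [he', h1]] at hmm'; exact absurd hmm'.symm (hei m' h2)
    · omega
  set S' := torusActionDeriv (fundamentalLatticeRep N) (suExp N) i a with hS'def
  have hSi : ∀ m, m < n → IndepOf (e m) S' := fun m hm =>
    indepOf_torusActionDeriv (fundamentalLatticeRep N) (suExp_add N)
      (X := fun X : SuGenerator N => (X : Matrix (Fin N) (Fin N) ℂ)) (rho_suExp N) (hei m hm) (hfar m hm) a
  intro hmem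
  have hkill := killL_eq_zero_of_mem_wordTruncation (fundamentalLatticeRep N) hinj hmem
  have hprod : (∏ m ∈ Finset.range n, reEntry (fundamentalLatticeRep N) (e m) a₀ a₀) =
      ∏ m ∈ Finset.range n, reEntry (fundamentalLatticeRep N) (e' m) a₀ a₀ :=
    Finset.prod_congr rfl fun m hm => by rw [he'lt m (Finset.mem_range.1 hm)]
  rw [hprod, killL_prod_reEntry_mul (fundamentalLatticeRep N) hinj _ _
    (fun m hm => by rw [he'lt m hm]; exact hSi m hm), he'n] at hkill
  obtain ⟨x, hx⟩ := exists_re_entry_ne_suN N hN a₀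
    (∫ g : Matrix.specialUnitaryGroup (Fin N) ℂ, ((fundamentalLatticeRep N).ρ g a₀ a₀).re ∂haarProbability _)
  refine prod_sub_const_mul_ne_zero (fundamentalLatticeRep N) e' _ _ hx
    (torusActionDeriv_sub_linkAvg_ne_zero (fundamentalLatticeRep N) (suExp_add N)
      (X := fun X : SuGenerator N => (X : Matrix (Fin N) (Fin N) ℂ)) (rho_suExp N) hS)
    (fun m hm => ?_) hkill
  rw [he'lt m hm]
  exact (hSi m hm).sub (indepOf_linkAvg (hSi m hm))

/-- ★★★ **The jump, unconditionally.** `SU(N)`, `N ≥ 2`, torus, level `n ≥ 4`, `∂_{i,a}S ≠ 0`,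
`e_0, …, e_{n-1}` distinct links different from `i` and sharing no plaquette with `i`,
`P = (∏_{m<n} Re (U_{e_m})₀₀) · ∂_{i,a}S` (a word observable of length `n + 4`): the level-`n` SDP
upper and lower bounds of `P` vanish at every `β ≠ 0`, while at `β = 0` the upper bound is
STRICTLY POSITIVE and the lower bound STRICTLY NEGATIVE. [folklore] -/
theorem sSup_levelValues_prodEntry_jump_suN (hN : 2 ≤ N) (a₀ : Fin N) {n : ℕ} (hn : 4 ≤ n) {i : Edge d L}
    {a : SuGenerator N} (hS : torusActionDeriv (fundamentalLatticeRep N) (suExp N) i a ≠ 0)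
    {e : ℕ → Edge d L} (he : Set.InjOn e (Set.Iio n)) (hei : ∀ m, m < n → e m ≠ i)
    (hfar : ∀ m, m < n → ∀ (x : Site d L) (j j' : Fin d), i ∈ plaqEdges x j j' → e m ∉ plaqEdges x j j') :
    (∀ β : ℝ, β ≠ 0 →
        sSup (levelValuesSuN (d := d) (L := L) N β n
          ((∏ m ∈ Finset.range n, reEntry (fundamentalLatticeRep N) (e m) a₀ a₀) *
            torusActionDeriv (fundamentalLatticeRep N) (suExp N) i a)) = 0 ∧
        sInf (levelValuesSuN (d := d) (L := L) N β n
          ((∏ m ∈ Finset.range n, reEntry (fundamentalLatticeRep N) (e m) a₀ a₀) *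
            torusActionDeriv (fundamentalLatticeRep N) (suExp N) i a)) = 0) ∧
      0 < sSup (levelValuesSuN (d := d) (L := L) N 0 n
          ((∏ m ∈ Finset.range n, reEntry (fundamentalLatticeRep N) (e m) a₀ a₀) *
            torusActionDeriv (fundamentalLatticeRep N) (suExp N) i a)) ∧
      sInf (levelValuesSuN (d := d) (L := L) N 0 n
          ((∏ m ∈ Finset.range n, reEntry (fundamentalLatticeRep N) (e m) a₀ a₀) *
            torusActionDeriv (fundamentalLatticeRep N) (suExp N) i a)) < 0 :=
  sSup_levelValues_jump_suN N hn (T := e '' Set.Iio n)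
    (by rintro ⟨m, hm, rfl⟩; exact hei m hm rfl) a
    (prod_reEntry_mem_wordSpace (fundamentalLatticeRep N) _ _ fun m hm => ⟨m, hm, rfl⟩)
    (prod_reEntry_mul_torusActionDeriv_not_mem_suN N hN a₀ hS he hei hfar)

/-- ★★★ **The level-`n` SDP upper bound of this objective is NOT continuous at `β = 0`** (indeed not
lower semicontinuous). [folklore] -/
theorem not_continuousAt_zero_sSup_levelValues_prodEntry_suN (hN : 2 ≤ N) (a₀ : Fin N) {n : ℕ} (hn : 4 ≤ n)
    {i : Edge d L} {a : SuGenerator N} (hS : torusActionDeriv (fundamentalLatticeRep N) (suExp N) i a ≠ 0)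
    {e : ℕ → Edge d L} (he : Set.InjOn e (Set.Iio n)) (hei : ∀ m, m < n → e m ≠ i)
    (hfar : ∀ m, m < n → ∀ (x : Site d L) (j j' : Fin d), i ∈ plaqEdges x j j' → e m ∉ plaqEdges x j j') :
    ¬ LowerSemicontinuousAt (fun β : ℝ => sSup (levelValuesSuN (d := d) (L := L) N β n
        ((∏ m ∈ Finset.range n, reEntry (fundamentalLatticeRep N) (e m) a₀ a₀) *
          torusActionDeriv (fundamentalLatticeRep N) (suExp N) i a))) 0 ∧
      ¬ ContinuousAt (fun β : ℝ => sSup (levelValuesSuN (d := d) (L := L) N β n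
        ((∏ m ∈ Finset.range n, reEntry (fundamentalLatticeRep N) (e m) a₀ a₀) *
          torusActionDeriv (fundamentalLatticeRep N) (suExp N) i a))) 0 := by
  have hi : i ∉ e '' Set.Iio n := by rintro ⟨m, hm, rfl⟩; exact hei m hm rfl
  have hf := prod_reEntry_mem_wordSpace (fundamentalLatticeRep N) (T := e '' Set.Iio n) (e := e)
    (a₀ : Fin (fundamentalLatticeRep N).N) a₀ (n := n) fun m hm => ⟨m, hm, rfl⟩
  have hP := prod_reEntry_mul_torusActionDeriv_not_mem_suN N hN a₀ hS he hei hfar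
  have h1 := not_lowerSemicontinuousAt_sSup_levelValues_suN N hn hi a hf hP
  exact ⟨h1, fun h => h1 h.lowerSemicontinuousAt⟩

end SuN

end Summit.QuantumFields.GaugeBoot

end
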